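import Literature.MathematicalPhysics.QuantumLattice.TypeClassSidecarReaderUCellTPrime
import HarnessLib

/-!
# The Markov + zero-entropy temperature cell on a `U`-BOX: the hot (C1) input at the LEFT end moves up in `U` for
# free, the cold input is the `T = 0` row AT the target `U`; kinematic edition below the anchor; `t' ≠ 0` by transport

Family `hubbard` (topic `MathematicalPhysics/QuantumLattice`), seat hubbard-downfold-unc-1 (the `U` direction of «a parameter BOX
maps to a certified word»). The COLDEST certified cells of the hubbard-thermal programme (`T ≤ t/3`, `T ≤ t/4`: the D-0099 headline
temperature) are not sidecar cells but MARKOV + ZERO-ENTROPY cells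
(`HubbardTorusMarkovClusterPressureTorusLimit.IsTorusLimitOfMixture.meanEnergy_hubbardTTPrime_le_of_eventually_hot_of_energyDensityTT'_le`:
a hot input `log Z_{β_h} ≤ (u + ε)L²` and a `T = 0` row `e(t,t',U,n) ≤ e⁺` give `e_Φ(ω) ≤ (u + β e⁺)/(β − β_h)`; with eng-2's staircase
certificate at `β_h = 3/4` and #354 this is the `T = t/4` edge `−0.4783993500` at `(8, 7/8, 0)`). This file words them on a `U`-interval:

* §1 ABSTRACT hot input at `U₁ ≤ U` (a pressure ceiling moves UP in `U` for free, `HubbardTTPrimePressureFloorUTransport` §2) and the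
  `T = 0` row AT the target `U`: `e_Φ(ω) ≤ (u + β e⁺)/(β − β_h)` for every torus limit at `(β, t, t', U, n)`
  (`…le_of_hot_left_U_of_energyDensityTT'_le`); from ONE anchor `U₀` on either side at the kinematic docc price
  `β_h·max(U₀ − U, 0)·n/2` (`…le_of_hot_anchorU_kinematic_of_energyDensityTT'_le`);
* §2 `t' = 0`, the hot input = a CORNER Markov certificate (window `Λ`, corner `x₀`, structured annihilator, dual `L_B`, constant `c`;
  rectangles AND staircases) at `(β_h, μ, U₁)`: `e_Φ(ω) ≤ ((c − β_h μ n) + β e⁺)/(β − β_h)` at every `U ≥ U₁`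
  (`…le_of_cornerMarkovCertificate_left_U_of_energyDensityTT'_le`, rect / stair corollaries), and the kinematic any-`U` edition;
* §3 `t' ≠ 0`, the SAME `t' = 0` certificate transported along `t'` (hubbard-thermal-p2's `TypeClassSidecarReaderTPrimeTransport`, price
  `β_h |t'| 16/π²`; `TypeClassSidecarReaderUCellTPrime` §0): `e_Φ(ω) ≤ ((c − β_h μ n) + β_h |t'| 16/π² + β e⁺)/(β − β_h)` at every `U ≥ U₁`,
  rect / stair corollaries, and the kinematic any-`U` edition.

So eng-2's `stair:2,2,1` certificate at `(3/4, U = 8)` and a `T = 0` cap row at the TARGET `U` (box-eng's `U`-face tangents / chords) word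
`T = t/4` on the whole `U`-face of both fast-cell boxes: free on `U ≥ 8`, kinematic below. Everything is PROVED; no definition, no named fact,
no number. HONEST SCOPE: the cold input is the zero-entropy bound (`log Z ≥ −β E₀`), so these cells are only as good as the `T = 0` cap at
the target `U`; nothing moves in `β` here. WHAT THIS IS NOT: no certificate, no phase sentence.

## Mathlib / tree search

REUSED: `IsTorusLimitOfMixture.meanEnergy_hubbardTTPrime_le_of_eventually_hot_of_energyDensityTT'_le`,
`eventually_log_partitionFn_sectorHamiltonianTT'_le_of_clusterCertificate` (`HubbardTorusMarkovClusterPressureTorusLimit`);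
`eventually_log_partitionFn_sectorHamiltonianTT'_le_fun_of_le_U`, `eventually_pressureCeiling_of_anchorU_kinematic`
(`HubbardTTPrimePressureFloorUTransport` §2); `eventually_log_partitionFn_sector_le_of_cornerMarkovCertificate_tPrimeTransport`
(`TypeClassSidecarReaderUCellTPrime` §0); corner / rect / stair bookkeeping as in `TypeClassSidecarReaderUCell`.
`rg 'hot_left_U_of_energyDensity|cornerMarkovCertificate_left_U_of_energyDensity' Literature/MathematicalPhysics/QuantumLattice` (2026-08-27): nothing.

## References

* D. Poulin, M. B. Hastings, Phys. Rev. Lett. 106 (2011) 080403, eqs. (3)–(8). [cite: PoulinHastings2011, eqs. (3)–(8)]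
* S. J. Gustafson, I. M. Sigal, *Mathematical Concepts of Quantum Mechanics*, §18.3 Theorem 18.10 (zero-entropy bound `Z ≥ e^{−βE₀}`).
  [cite: GustafsonSigal2003, §18.3 Theorem 18.10]
* R. B. Israel, *Convexity in the Theory of Lattice Gases* (1979), Thm. I.3.4, Lemma II.3.1. [cite: Israel1979, Thm. I.3.4] [cite: Israel1979, Lemma II.3.1]
* E. H. Lieb, Commun. Math. Phys. 31 (1973) 327, §V (5.2)–(5.4). [cite: Lieb1973, §V (5.2)–(5.4)]
-/

noncomputable section

namespace Literature.MathematicalPhysics.QuantumLattice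

open Matrix Finset HubbardWave0 ThermodynamicLimit LiebThm1 AndersonCluster Literature.Probability.LatticeModels
open _root_.Filter
open scoped _root_.Topology ComplexOrder BigOperators

namespace InfVolFermionState

variable {t t' U n β : ℝ} {ω : InfVolFermionState 2} {Ls : ℕ → ℕ}

/-! ### §1 Abstract hot input at the left end / at one anchor, `T = 0` row at the target -/

/-- **Hot input at `U₁ ≤ U`, cold input the `T = 0` row at `U`.** `ω` a torus limit of the canonical sector Gibbs states at
`(β, t, t', U, n)` along `Ls → ∞` (`U ≥ 0`, `0 ≤ n < 2`), `0 < β_h < β`; an eventual hot bound at the LEFT coupling `U₁ ≤ U`,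
`∀ ε > 0, ∀ᶠ j, log Re Z_{β_h}(H_{Ls j}(t,t',U₁)|_sector) ≤ (u + ε)(Ls j)²`, and a ground-state row `e(t,t',U,n) ≤ e⁺` at the target give
`e_Φ(ω) ≤ (u + β e⁺)/(β − β_h)` — the ceiling moves up in `U` for free. [cite: Israel1979, Thm. I.3.4] [cite: Israel1979, Lemma II.3.1]
[cite: GustafsonSigal2003, §18.3 Theorem 18.10] -/
theorem IsTorusLimitOfMixture.meanEnergy_hubbardTTPrime_le_of_hot_left_U_of_energyDensityTT'_le
    (hU0 : 0 ≤ U) (hn0 : 0 ≤ n) (hn2 : n < 2) {U₁ : ℝ} (hU1 : U₁ ≤ U)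
    (h : ω.IsTorusLimitOfMixture (sectorGibbsCount n) (fun L => sectorGibbsWeightTT' β t t' U n L)
      (fun L => sectorGibbsVectorTT' t t' U n L) Ls)
    (hLs : Tendsto Ls atTop atTop) {βh u : ℝ} (hβh : 0 < βh) (hlt : βh < β)
    (hu : ∀ ε : ℝ, 0 < ε → ∀ᶠ j in atTop,
      Real.log (partitionFn βh (sectorHamiltonianTT' t t' U₁ n (Ls j))).re ≤ (u + ε) * (Ls j : ℝ) ^ 2)
    {eup : ℝ} (he : energyDensityTT' t t' U n ≤ eup) :
    ω.meanEnergy (hubbardTTPrimeFermionInteraction t t' U) 1 ≤ (u + β * eup) / (β - βh) :=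
  h.meanEnergy_hubbardTTPrime_le_of_eventually_hot_of_energyDensityTT'_le hU0 hn0 hn2 hLs hβh hlt
    (fun ε hε => eventually_log_partitionFn_sectorHamiltonianTT'_le_fun_of_le_U hn0 hn2.le t t' hβh.le hU1 hLs (hu ε hε)) he

/-- **Hot input at ONE anchor `U₀` (either side), kinematic price, cold input the `T = 0` row at `U`**:
`e_Φ(ω) ≤ (u + β_h·max(U₀ − U, 0)·n/2 + β e⁺)/(β − β_h)` (above the anchor the ceiling is free, below it pays the kinematic docc
price). [cite: Lieb1973, §V (5.2)–(5.4)] [cite: Israel1979, Lemma II.3.1] [cite: GustafsonSigal2003, §18.3 Theorem 18.10] -/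
theorem IsTorusLimitOfMixture.meanEnergy_hubbardTTPrime_le_of_hot_anchorU_kinematic_of_energyDensityTT'_le
    (hU0 : 0 ≤ U) (hn0 : 0 ≤ n) (hn2 : n < 2) (U₀ : ℝ)
    (h : ω.IsTorusLimitOfMixture (sectorGibbsCount n) (fun L => sectorGibbsWeightTT' β t t' U n L)
      (fun L => sectorGibbsVectorTT' t t' U n L) Ls)
    (hLs : Tendsto Ls atTop atTop) {βh u : ℝ} (hβh : 0 < βh) (hlt : βh < β)
    (hu : ∀ ε : ℝ, 0 < ε → ∀ᶠ j in atTop,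
      Real.log (partitionFn βh (sectorHamiltonianTT' t t' U₀ n (Ls j))).re ≤ (u + ε) * (Ls j : ℝ) ^ 2)
    {eup : ℝ} (he : energyDensityTT' t t' U n ≤ eup) :
    ω.meanEnergy (hubbardTTPrimeFermionInteraction t t' U) 1 ≤ (u + βh * max (U₀ - U) 0 * (n / 2) + β * eup) / (β - βh) :=
  h.meanEnergy_hubbardTTPrime_le_of_eventually_hot_of_energyDensityTT'_le hU0 hn0 hn2 hLs hβh hlt
    (fun _ hε => eventually_pressureCeiling_of_anchorU_kinematic hn0 hn2.le t t' hβh.le U₀ U hLs hu hε) he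

/-! ### §2 `t' = 0`: corner Markov certificate at the left end / at one anchor -/

/-- **`t' = 0`: CORNER Markov certificate at `(β_h, μ, U₁)`, `U₁ ≤ U`, `T = 0` row at `U`** (`U ≥ 0`, `0 ≤ n < 2`, `0 < β_h < β`;
window `Λ ⊆ [0, ℓ_w)²` with corner `x₀`, `x₀ − eᵢ ∈ Λ`, structured annihilator, Hermitian dual `L_B`, constant `c`): for every torus limit
at `(β, t, 0, U, n)`, `e_Φ(ω) ≤ ((c − β_h μ n) + β e⁺)/(β − β_h)`. [cite: PoulinHastings2011, eqs. (3)–(8)] [cite: Israel1979, Thm. I.3.4]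
[cite: GustafsonSigal2003, §18.3 Theorem 18.10] -/
theorem IsTorusLimitOfMixture.meanEnergy_hubbardTTPrime_le_of_cornerMarkovCertificate_left_U_of_energyDensityTT'_le
    (hU0 : 0 ≤ U) (hn0 : 0 ≤ n) (hn2 : n < 2) {U₁ : ℝ} (hU1 : U₁ ≤ U)
    (h : ω.IsTorusLimitOfMixture (sectorGibbsCount n) (fun L => sectorGibbsWeightTT' β t 0 U n L)
      (fun L => sectorGibbsVectorTT' t 0 U n L) Ls)
    (hLs : Tendsto Ls atTop atTop) {βh : ℝ} (hβh : 0 < βh) (hlt : βh < β)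
    (μ : ℝ) {Λ : Finset (Site 2)} {x₀ : Site 2} (hx₀ : x₀ ∈ Λ) (hmax : ∀ y ∈ Λ, toLex y ≤ toLex x₀)
    (hcorner : ∀ i : Fin 2, x₀ - unitVec i ∈ Λ) {ℓw : ℕ} (hΛ : Λ ⊆ halfOpenBox 2 ℓw)
    {ι : Type*} (sι : Finset ι) (Sw : ι → Finset (Site 2)) (hS : ∀ i, Sw i ⊆ Λ) (zw : ι → Site 2)
    (hzw : ∀ i, shiftSet (zw i) (Sw i) ⊆ Λ) {O : ∀ i, FermionOp (Sw i)} (hO : ∀ i ∈ sι, (O i).IsHermitian)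
    (g : ι → ℝ) {LB : FermionOp (Λ.erase x₀)} (hLB : LB.IsHermitian) {c : ℝ}
    (hcert : ((Real.exp c : ℂ) • cfc Real.exp LB -
      fermionPartialTrace (PolySite.incl (Finset.erase_subset x₀ Λ))
        (cfc Real.exp (-((βh : ℂ) • (cornerEnergyRep Λ x₀ t U₁ μ + windowAnnihilator sι Λ Sw hS zw hzw O g)) +
          fermionEmbed (PolySite.incl (Finset.erase_subset x₀ Λ)) LB))).PosSemidef)
    {eup : ℝ} (he : energyDensityTT' t 0 U n ≤ eup) :
    ω.meanEnergy (hubbardTTPrimeFermionInteraction t 0 U) 1 ≤ ((c - βh * μ * n) + β * eup) / (β - βh) := by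
  have hKTI : ∀ (L : ℕ) [NeZero L], ∀ w : TorusSite 2 L,
      relabel (Orb.translate w) (hubbardTorusTT' L t 0 U₁ - (μ : ℂ) • totalNumber) =
        hubbardTorusTT' L t 0 U₁ - (μ : ℂ) • totalNumber := fun L _ w => by
    rw [hubbardTorusTT'_zero_sub_mu, relabel_translate_hubbardTorusWith]
  exact h.meanEnergy_hubbardTTPrime_le_of_hot_left_U_of_energyDensityTT'_le hU0 hn0 hn2 hU1 hLs hβh hlt
    (fun ε hε => eventually_log_partitionFn_sectorHamiltonianTT'_le_of_clusterCertificate t U₁ μ βh hn0 hn2.le hLs hx₀ hmax hΛ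
      (fun i => bondWeightSum_cornerBondWeight hx₀ (hcorner i)) (siteWeightSum_cornerSiteWeight hx₀)
      (siteWeightSum_mul_cornerSiteWeight hx₀ (-μ)) (isHermitian_windowAnnihilator sι _ Sw hS zw hzw hO g)
      (fun L _ hL3 hℓL => trace_window_mul_windowAnnihilator (relabel_translate_gibbsDensity L (hKTI L) βh)
        _ sι Sw hS zw hzw O g) hLB hcert hε) he

/-- **Rectangle corollary** (`Λ = rectWindow a' b'`, corner `(a' − 1, b' − 1)`, `a', b' ≥ 2`): C1 at `(β_h, μ, U₁)`, `U₁ ≤ U`, `T = 0`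
row at `U` ⇒ `e_Φ(ω) ≤ ((c − β_h μ n) + β e⁺)/(β − β_h)`. [cite: PoulinHastings2011, eqs. (3)–(8)] [cite: Israel1979, Thm. I.3.4] -/
theorem IsTorusLimitOfMixture.meanEnergy_hubbardTTPrime_le_of_rectMarkovCertificate_left_U_of_energyDensityTT'_le
    (hU0 : 0 ≤ U) (hn0 : 0 ≤ n) (hn2 : n < 2) {U₁ : ℝ} (hU1 : U₁ ≤ U)
    (h : ω.IsTorusLimitOfMixture (sectorGibbsCount n) (fun L => sectorGibbsWeightTT' β t 0 U n L)
      (fun L => sectorGibbsVectorTT' t 0 U n L) Ls)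
    (hLs : Tendsto Ls atTop atTop) {βh : ℝ} (hβh : 0 < βh) (hlt : βh < β)
    (μ : ℝ) {a' b' : ℕ} (ha' : 2 ≤ a') (hb' : 2 ≤ b')
    {ι : Type*} (sι : Finset ι) (Sw : ι → Finset (Site 2)) (hS : ∀ i, Sw i ⊆ rectWindow a' b') (zw : ι → Site 2)
    (hzw : ∀ i, shiftSet (zw i) (Sw i) ⊆ rectWindow a' b') {O : ∀ i, FermionOp (Sw i)}
    (hO : ∀ i ∈ sι, (O i).IsHermitian) (g : ι → ℝ)
    {LB : FermionOp ((rectWindow a' b').erase (mkSite2 (a' - 1) (b' - 1)))} (hLB : LB.IsHermitian) {c : ℝ}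
    (hcert : ((Real.exp c : ℂ) • cfc Real.exp LB -
      fermionPartialTrace (PolySite.incl (Finset.erase_subset (mkSite2 (a' - 1) (b' - 1)) (rectWindow a' b')))
        (cfc Real.exp (-((βh : ℂ) • (cornerEnergyRep (rectWindow a' b') (mkSite2 (a' - 1) (b' - 1)) t U₁ μ +
            windowAnnihilator sι (rectWindow a' b') Sw hS zw hzw O g)) +
          fermionEmbed (PolySite.incl (Finset.erase_subset (mkSite2 (a' - 1) (b' - 1)) (rectWindow a' b'))) LB))).PosSemidef)
    {eup : ℝ} (he : energyDensityTT' t 0 U n ≤ eup) :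
    ω.meanEnergy (hubbardTTPrimeFermionInteraction t 0 U) 1 ≤ ((c - βh * μ * n) + β * eup) / (β - βh) :=
  h.meanEnergy_hubbardTTPrime_le_of_cornerMarkovCertificate_left_U_of_energyDensityTT'_le hU0 hn0 hn2 hU1 hLs hβh hlt μ
    (rectCorner_mem_rectWindow (by omega) (by omega)) toLex_le_toLex_rectCorner (rectCorner_sub_unitVec_mem_rectWindow ha' hb')
    (rectWindow_subset_halfOpenBox_max a' b') sι Sw hS zw hzw hO g hLB hcert he

/-- **Staircase corollary** (`Λ = stairWindow lo₁ hi₁ lo₀ hi₀`, corner `(1, hi₁ − 1)`, `lo₁ + 2 ≤ hi₁`, `lo₀ + 1 ≤ hi₁ ≤ hi₀`; the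
producer's `stair:2,2,1` = `stairWindow 0 3 0 4`): C1 at `(β_h, μ, U₁)`, `U₁ ≤ U`, `T = 0` row at `U` ⇒
`e_Φ(ω) ≤ ((c − β_h μ n) + β e⁺)/(β − β_h)`. [cite: PoulinHastings2011, eqs. (3)–(8)] [cite: Israel1979, Thm. I.3.4] -/
theorem IsTorusLimitOfMixture.meanEnergy_hubbardTTPrime_le_of_stairMarkovCertificate_left_U_of_energyDensityTT'_le
    (hU0 : 0 ≤ U) (hn0 : 0 ≤ n) (hn2 : n < 2) {U₁ : ℝ} (hU1 : U₁ ≤ U)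
    (h : ω.IsTorusLimitOfMixture (sectorGibbsCount n) (fun L => sectorGibbsWeightTT' β t 0 U n L)
      (fun L => sectorGibbsVectorTT' t 0 U n L) Ls)
    (hLs : Tendsto Ls atTop atTop) {βh : ℝ} (hβh : 0 < βh) (hlt : βh < β)
    (μ : ℝ) {lo₁ hi₁ lo₀ hi₀ : ℕ} (h₁ : lo₁ + 2 ≤ hi₁) (h₀ : lo₀ + 1 ≤ hi₁) (h₀' : hi₁ ≤ hi₀)
    {ι : Type*} (sι : Finset ι) (Sw : ι → Finset (Site 2)) (hS : ∀ i, Sw i ⊆ stairWindow lo₁ hi₁ lo₀ hi₀)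
    (zw : ι → Site 2) (hzw : ∀ i, shiftSet (zw i) (Sw i) ⊆ stairWindow lo₁ hi₁ lo₀ hi₀) {O : ∀ i, FermionOp (Sw i)}
    (hO : ∀ i ∈ sι, (O i).IsHermitian) (g : ι → ℝ)
    {LB : FermionOp ((stairWindow lo₁ hi₁ lo₀ hi₀).erase (mkSite2 1 (hi₁ - 1)))} (hLB : LB.IsHermitian) {c : ℝ}
    (hcert : ((Real.exp c : ℂ) • cfc Real.exp LB -
      fermionPartialTrace (PolySite.incl (Finset.erase_subset (mkSite2 1 (hi₁ - 1)) (stairWindow lo₁ hi₁ lo₀ hi₀)))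
        (cfc Real.exp (-((βh : ℂ) • (cornerEnergyRep (stairWindow lo₁ hi₁ lo₀ hi₀) (mkSite2 1 (hi₁ - 1)) t U₁ μ +
            windowAnnihilator sι (stairWindow lo₁ hi₁ lo₀ hi₀) Sw hS zw hzw O g)) +
          fermionEmbed (PolySite.incl (Finset.erase_subset (mkSite2 1 (hi₁ - 1)) (stairWindow lo₁ hi₁ lo₀ hi₀))) LB))).PosSemidef)
    {eup : ℝ} (he : energyDensityTT' t 0 U n ≤ eup) :
    ω.meanEnergy (hubbardTTPrimeFermionInteraction t 0 U) 1 ≤ ((c - βh * μ * n) + β * eup) / (β - βh) :=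
  h.meanEnergy_hubbardTTPrime_le_of_cornerMarkovCertificate_left_U_of_energyDensityTT'_le hU0 hn0 hn2 hU1 hLs hβh hlt μ
    (stairCorner_mem_stairWindow (by omega)) toLex_le_toLex_stairCorner (stairCorner_sub_unitVec_mem_stairWindow h₁ h₀ h₀')
    (stairWindow_subset_halfOpenBox lo₁ hi₁ lo₀ hi₀) sι Sw hS zw hzw hO g hLB hcert he

/-- **`t' = 0`, ONE anchor `U₀`, kinematic price below it**: CORNER Markov certificate at `(β_h, μ, U₀)`, `T = 0` row at `U` ⇒
`e_Φ(ω) ≤ ((c − β_h μ n) + β_h·max(U₀ − U, 0)·n/2 + β e⁺)/(β − β_h)` for every torus limit at `(β, t, 0, U, n)`, every `U ≥ 0`.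
[cite: PoulinHastings2011, eqs. (3)–(8)] [cite: Lieb1973, §V (5.2)–(5.4)] [cite: GustafsonSigal2003, §18.3 Theorem 18.10] -/
theorem IsTorusLimitOfMixture.meanEnergy_hubbardTTPrime_le_of_cornerMarkovCertificate_anchorU_kinematic_of_energyDensityTT'_le
    (hU0 : 0 ≤ U) (hn0 : 0 ≤ n) (hn2 : n < 2) (U₀ : ℝ)
    (h : ω.IsTorusLimitOfMixture (sectorGibbsCount n) (fun L => sectorGibbsWeightTT' β t 0 U n L)
      (fun L => sectorGibbsVectorTT' t 0 U n L) Ls)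
    (hLs : Tendsto Ls atTop atTop) {βh : ℝ} (hβh : 0 < βh) (hlt : βh < β)
    (μ : ℝ) {Λ : Finset (Site 2)} {x₀ : Site 2} (hx₀ : x₀ ∈ Λ) (hmax : ∀ y ∈ Λ, toLex y ≤ toLex x₀)
    (hcorner : ∀ i : Fin 2, x₀ - unitVec i ∈ Λ) {ℓw : ℕ} (hΛ : Λ ⊆ halfOpenBox 2 ℓw)
    {ι : Type*} (sι : Finset ι) (Sw : ι → Finset (Site 2)) (hS : ∀ i, Sw i ⊆ Λ) (zw : ι → Site 2)
    (hzw : ∀ i, shiftSet (zw i) (Sw i) ⊆ Λ) {O : ∀ i, FermionOp (Sw i)} (hO : ∀ i ∈ sι, (O i).IsHermitian)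
    (g : ι → ℝ) {LB : FermionOp (Λ.erase x₀)} (hLB : LB.IsHermitian) {c : ℝ}
    (hcert : ((Real.exp c : ℂ) • cfc Real.exp LB -
      fermionPartialTrace (PolySite.incl (Finset.erase_subset x₀ Λ))
        (cfc Real.exp (-((βh : ℂ) • (cornerEnergyRep Λ x₀ t U₀ μ + windowAnnihilator sι Λ Sw hS zw hzw O g)) +
          fermionEmbed (PolySite.incl (Finset.erase_subset x₀ Λ)) LB))).PosSemidef)
    {eup : ℝ} (he : energyDensityTT' t 0 U n ≤ eup) :
    ω.meanEnergy (hubbardTTPrimeFermionInteraction t 0 U) 1 ≤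
      ((c - βh * μ * n) + βh * max (U₀ - U) 0 * (n / 2) + β * eup) / (β - βh) := by
  have hKTI : ∀ (L : ℕ) [NeZero L], ∀ w : TorusSite 2 L,
      relabel (Orb.translate w) (hubbardTorusTT' L t 0 U₀ - (μ : ℂ) • totalNumber) =
        hubbardTorusTT' L t 0 U₀ - (μ : ℂ) • totalNumber := fun L _ w => by
    rw [hubbardTorusTT'_zero_sub_mu, relabel_translate_hubbardTorusWith]
  exact h.meanEnergy_hubbardTTPrime_le_of_hot_anchorU_kinematic_of_energyDensityTT'_le hU0 hn0 hn2 U₀ hLs hβh hlt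
    (fun ε hε => eventually_log_partitionFn_sectorHamiltonianTT'_le_of_clusterCertificate t U₀ μ βh hn0 hn2.le hLs hx₀ hmax hΛ
      (fun i => bondWeightSum_cornerBondWeight hx₀ (hcorner i)) (siteWeightSum_cornerSiteWeight hx₀)
      (siteWeightSum_mul_cornerSiteWeight hx₀ (-μ)) (isHermitian_windowAnnihilator sι _ Sw hS zw hzw hO g)
      (fun L _ hL3 hℓL => trace_window_mul_windowAnnihilator (relabel_translate_gibbsDensity L (hKTI L) βh)
        _ sι Sw hS zw hzw O g) hLB hcert hε) he

/-! ### §3 `t' ≠ 0`: the `t' = 0` corner certificate transported along `t'` -/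

/-- **`t' ≠ 0`: the `t' = 0` CORNER Markov certificate at `(β_h, μ, U₁)` transported along `t'` (price `β_h |t'| 16/π²`), `U₁ ≤ U`,
`T = 0` row `e(t,t',U,n) ≤ e⁺` at the target**: for every torus limit at `(β, t, t', U, n)` (`U ≥ 0`, `0 ≤ n < 2`, `0 < β_h < β`),
`e_Φ(ω) ≤ ((c − β_h μ n) + β_h |t'| 16/π² + β e⁺)/(β − β_h)`. [cite: PoulinHastings2011, eqs. (3)–(8)] [cite: Lieb1973, §V (5.2)–(5.4)]
[cite: Israel1979, Thm. I.3.4] [cite: GustafsonSigal2003, §18.3 Theorem 18.10] -/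
theorem IsTorusLimitOfMixture.meanEnergy_hubbardTTPrime_le_of_cornerMarkovCertificate_tPrimeTransport_left_U_of_energyDensityTT'_le
    (hU0 : 0 ≤ U) (hn0 : 0 ≤ n) (hn2 : n < 2) {U₁ : ℝ} (hU1 : U₁ ≤ U)
    (h : ω.IsTorusLimitOfMixture (sectorGibbsCount n) (fun L => sectorGibbsWeightTT' β t t' U n L)
      (fun L => sectorGibbsVectorTT' t t' U n L) Ls)
    (hLs : Tendsto Ls atTop atTop) {βh : ℝ} (hβh : 0 < βh) (hlt : βh < β)
    (μ : ℝ) {Λ : Finset (Site 2)} {x₀ : Site 2} (hx₀ : x₀ ∈ Λ) (hmax : ∀ y ∈ Λ, toLex y ≤ toLex x₀)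
    (hcorner : ∀ i : Fin 2, x₀ - unitVec i ∈ Λ) {ℓw : ℕ} (hΛ : Λ ⊆ halfOpenBox 2 ℓw)
    {ι : Type*} (sι : Finset ι) (Sw : ι → Finset (Site 2)) (hS : ∀ i, Sw i ⊆ Λ) (zw : ι → Site 2)
    (hzw : ∀ i, shiftSet (zw i) (Sw i) ⊆ Λ) {O : ∀ i, FermionOp (Sw i)} (hO : ∀ i ∈ sι, (O i).IsHermitian)
    (g : ι → ℝ) {LB : FermionOp (Λ.erase x₀)} (hLB : LB.IsHermitian) {c : ℝ}
    (hcert : ((Real.exp c : ℂ) • cfc Real.exp LB -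
      fermionPartialTrace (PolySite.incl (Finset.erase_subset x₀ Λ))
        (cfc Real.exp (-((βh : ℂ) • (cornerEnergyRep Λ x₀ t U₁ μ + windowAnnihilator sι Λ Sw hS zw hzw O g)) +
          fermionEmbed (PolySite.incl (Finset.erase_subset x₀ Λ)) LB))).PosSemidef)
    {eup : ℝ} (he : energyDensityTT' t t' U n ≤ eup) :
    ω.meanEnergy (hubbardTTPrimeFermionInteraction t t' U) 1 ≤
      ((c - βh * μ * n) + βh * |t'| * (16 / Real.pi ^ 2) + β * eup) / (β - βh) :=
  h.meanEnergy_hubbardTTPrime_le_of_hot_left_U_of_energyDensityTT'_le hU0 hn0 hn2 hU1 hLs hβh hlt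
    (eventually_log_partitionFn_sector_le_of_cornerMarkovCertificate_tPrimeTransport hn0 hn2 t t' U₁ hβh hLs μ hx₀ hmax hcorner
      hΛ sι Sw hS zw hzw hO g hLB hcert) he

/-- **Rectangle corollary at `t' ≠ 0`** (`Λ = rectWindow a' b'`, `a', b' ≥ 2`): transported rectangle C1 at the left end `U₁ ≤ U`,
`T = 0` row at `U` ⇒ `e_Φ(ω) ≤ ((c − β_h μ n) + β_h |t'| 16/π² + β e⁺)/(β − β_h)`. [cite: PoulinHastings2011, eqs. (3)–(8)] [cite: Lieb1973, §V (5.2)–(5.4)] -/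
theorem IsTorusLimitOfMixture.meanEnergy_hubbardTTPrime_le_of_rectMarkovCertificate_tPrimeTransport_left_U_of_energyDensityTT'_le
    (hU0 : 0 ≤ U) (hn0 : 0 ≤ n) (hn2 : n < 2) {U₁ : ℝ} (hU1 : U₁ ≤ U)
    (h : ω.IsTorusLimitOfMixture (sectorGibbsCount n) (fun L => sectorGibbsWeightTT' β t t' U n L)
      (fun L => sectorGibbsVectorTT' t t' U n L) Ls)
    (hLs : Tendsto Ls atTop atTop) {βh : ℝ} (hβh : 0 < βh) (hlt : βh < β)
    (μ : ℝ) {a' b' : ℕ} (ha' : 2 ≤ a') (hb' : 2 ≤ b')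
    {ι : Type*} (sι : Finset ι) (Sw : ι → Finset (Site 2)) (hS : ∀ i, Sw i ⊆ rectWindow a' b') (zw : ι → Site 2)
    (hzw : ∀ i, shiftSet (zw i) (Sw i) ⊆ rectWindow a' b') {O : ∀ i, FermionOp (Sw i)}
    (hO : ∀ i ∈ sι, (O i).IsHermitian) (g : ι → ℝ)
    {LB : FermionOp ((rectWindow a' b').erase (mkSite2 (a' - 1) (b' - 1)))} (hLB : LB.IsHermitian) {c : ℝ}
    (hcert : ((Real.exp c : ℂ) • cfc Real.exp LB -
      fermionPartialTrace (PolySite.incl (Finset.erase_subset (mkSite2 (a' - 1) (b' - 1)) (rectWindow a' b')))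
        (cfc Real.exp (-((βh : ℂ) • (cornerEnergyRep (rectWindow a' b') (mkSite2 (a' - 1) (b' - 1)) t U₁ μ +
            windowAnnihilator sι (rectWindow a' b') Sw hS zw hzw O g)) +
          fermionEmbed (PolySite.incl (Finset.erase_subset (mkSite2 (a' - 1) (b' - 1)) (rectWindow a' b'))) LB))).PosSemidef)
    {eup : ℝ} (he : energyDensityTT' t t' U n ≤ eup) :
    ω.meanEnergy (hubbardTTPrimeFermionInteraction t t' U) 1 ≤
      ((c - βh * μ * n) + βh * |t'| * (16 / Real.pi ^ 2) + β * eup) / (β - βh) :=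
  h.meanEnergy_hubbardTTPrime_le_of_cornerMarkovCertificate_tPrimeTransport_left_U_of_energyDensityTT'_le hU0 hn0 hn2 hU1 hLs
    hβh hlt μ (rectCorner_mem_rectWindow (by omega) (by omega)) toLex_le_toLex_rectCorner
    (rectCorner_sub_unitVec_mem_rectWindow ha' hb') (rectWindow_subset_halfOpenBox_max a' b') sι Sw hS zw hzw hO g hLB hcert he

/-- **Staircase corollary at `t' ≠ 0`** (`Λ = stairWindow lo₁ hi₁ lo₀ hi₀`, corner `(1, hi₁ − 1)`): transported staircase C1 at the
left end `U₁ ≤ U`, `T = 0` row at `U` ⇒ `e_Φ(ω) ≤ ((c − β_h μ n) + β_h |t'| 16/π² + β e⁺)/(β − β_h)`.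
[cite: PoulinHastings2011, eqs. (3)–(8)] [cite: Lieb1973, §V (5.2)–(5.4)] -/
theorem IsTorusLimitOfMixture.meanEnergy_hubbardTTPrime_le_of_stairMarkovCertificate_tPrimeTransport_left_U_of_energyDensityTT'_le
    (hU0 : 0 ≤ U) (hn0 : 0 ≤ n) (hn2 : n < 2) {U₁ : ℝ} (hU1 : U₁ ≤ U)
    (h : ω.IsTorusLimitOfMixture (sectorGibbsCount n) (fun L => sectorGibbsWeightTT' β t t' U n L)
      (fun L => sectorGibbsVectorTT' t t' U n L) Ls)
    (hLs : Tendsto Ls atTop atTop) {βh : ℝ} (hβh : 0 < βh) (hlt : βh < β)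
    (μ : ℝ) {lo₁ hi₁ lo₀ hi₀ : ℕ} (h₁ : lo₁ + 2 ≤ hi₁) (h₀ : lo₀ + 1 ≤ hi₁) (h₀' : hi₁ ≤ hi₀)
    {ι : Type*} (sι : Finset ι) (Sw : ι → Finset (Site 2)) (hS : ∀ i, Sw i ⊆ stairWindow lo₁ hi₁ lo₀ hi₀)
    (zw : ι → Site 2) (hzw : ∀ i, shiftSet (zw i) (Sw i) ⊆ stairWindow lo₁ hi₁ lo₀ hi₀) {O : ∀ i, FermionOp (Sw i)}
    (hO : ∀ i ∈ sι, (O i).IsHermitian) (g : ι → ℝ)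
    {LB : FermionOp ((stairWindow lo₁ hi₁ lo₀ hi₀).erase (mkSite2 1 (hi₁ - 1)))} (hLB : LB.IsHermitian) {c : ℝ}
    (hcert : ((Real.exp c : ℂ) • cfc Real.exp LB -
      fermionPartialTrace (PolySite.incl (Finset.erase_subset (mkSite2 1 (hi₁ - 1)) (stairWindow lo₁ hi₁ lo₀ hi₀)))
        (cfc Real.exp (-((βh : ℂ) • (cornerEnergyRep (stairWindow lo₁ hi₁ lo₀ hi₀) (mkSite2 1 (hi₁ - 1)) t U₁ μ +
            windowAnnihilator sι (stairWindow lo₁ hi₁ lo₀ hi₀) Sw hS zw hzw O g)) +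
          fermionEmbed (PolySite.incl (Finset.erase_subset (mkSite2 1 (hi₁ - 1)) (stairWindow lo₁ hi₁ lo₀ hi₀))) LB))).PosSemidef)
    {eup : ℝ} (he : energyDensityTT' t t' U n ≤ eup) :
    ω.meanEnergy (hubbardTTPrimeFermionInteraction t t' U) 1 ≤
      ((c - βh * μ * n) + βh * |t'| * (16 / Real.pi ^ 2) + β * eup) / (β - βh) :=
  h.meanEnergy_hubbardTTPrime_le_of_cornerMarkovCertificate_tPrimeTransport_left_U_of_energyDensityTT'_le hU0 hn0 hn2 hU1 hLs
    hβh hlt μ (stairCorner_mem_stairWindow (by omega)) toLex_le_toLex_stairCorner (stairCorner_sub_unitVec_mem_stairWindow h₁ h₀ h₀')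
    (stairWindow_subset_halfOpenBox lo₁ hi₁ lo₀ hi₀) sι Sw hS zw hzw hO g hLB hcert he

/-- **`t' ≠ 0`, ONE anchor `U₀`, kinematic price below it**: transported CORNER Markov certificate at `(β_h, μ, U₀)`, `T = 0` row at
`U` ⇒ `e_Φ(ω) ≤ ((c − β_h μ n) + β_h |t'| 16/π² + β_h·max(U₀ − U, 0)·n/2 + β e⁺)/(β − β_h)` for every torus limit at
`(β, t, t', U, n)`, `U ≥ 0`. [cite: PoulinHastings2011, eqs. (3)–(8)] [cite: Lieb1973, §V (5.2)–(5.4)] [cite: GustafsonSigal2003, §18.3 Theorem 18.10] -/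
theorem IsTorusLimitOfMixture.meanEnergy_hubbardTTPrime_le_of_cornerMarkovCertificate_tPrimeTransport_anchorU_kinematic_of_energyDensityTT'_le
    (hU0 : 0 ≤ U) (hn0 : 0 ≤ n) (hn2 : n < 2) (U₀ : ℝ)
    (h : ω.IsTorusLimitOfMixture (sectorGibbsCount n) (fun L => sectorGibbsWeightTT' β t t' U n L)
      (fun L => sectorGibbsVectorTT' t t' U n L) Ls)
    (hLs : Tendsto Ls atTop atTop) {βh : ℝ} (hβh : 0 < βh) (hlt : βh < β)
    (μ : ℝ) {Λ : Finset (Site 2)} {x₀ : Site 2} (hx₀ : x₀ ∈ Λ) (hmax : ∀ y ∈ Λ, toLex y ≤ toLex x₀)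
    (hcorner : ∀ i : Fin 2, x₀ - unitVec i ∈ Λ) {ℓw : ℕ} (hΛ : Λ ⊆ halfOpenBox 2 ℓw)
    {ι : Type*} (sι : Finset ι) (Sw : ι → Finset (Site 2)) (hS : ∀ i, Sw i ⊆ Λ) (zw : ι → Site 2)
    (hzw : ∀ i, shiftSet (zw i) (Sw i) ⊆ Λ) {O : ∀ i, FermionOp (Sw i)} (hO : ∀ i ∈ sι, (O i).IsHermitian)
    (g : ι → ℝ) {LB : FermionOp (Λ.erase x₀)} (hLB : LB.IsHermitian) {c : ℝ}
    (hcert : ((Real.exp c : ℂ) • cfc Real.exp LB -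
      fermionPartialTrace (PolySite.incl (Finset.erase_subset x₀ Λ))
        (cfc Real.exp (-((βh : ℂ) • (cornerEnergyRep Λ x₀ t U₀ μ + windowAnnihilator sι Λ Sw hS zw hzw O g)) +
          fermionEmbed (PolySite.incl (Finset.erase_subset x₀ Λ)) LB))).PosSemidef)
    {eup : ℝ} (he : energyDensityTT' t t' U n ≤ eup) :
    ω.meanEnergy (hubbardTTPrimeFermionInteraction t t' U) 1 ≤
      (((c - βh * μ * n) + βh * |t'| * (16 / Real.pi ^ 2)) + βh * max (U₀ - U) 0 * (n / 2) + β * eup) / (β - βh) :=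
  h.meanEnergy_hubbardTTPrime_le_of_hot_anchorU_kinematic_of_energyDensityTT'_le hU0 hn0 hn2 U₀ hLs hβh hlt
    (eventually_log_partitionFn_sector_le_of_cornerMarkovCertificate_tPrimeTransport hn0 hn2 t t' U₀ hβh hLs μ hx₀ hmax hcorner
      hΛ sι Sw hS zw hzw hO g hLB hcert) he

end InfVolFermionState

end Literature.MathematicalPhysics.QuantumLattice

end
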